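import Summits.CriticalPhenomena.Ising3DConformalLimit.Theorems.PrecisionLaplacianDirectCorrelationStableTailPickInversionAux13
import Summits.CriticalPhenomena.Ising3DConformalLimit.Theorems.PrecisionLaplacianDirectCorrelationStableTailSlabSpectralRepresentation
import Literature.Probability.LatticeModels.LatticeGreenLineEnergy

/-!
# Pick inversion, auxiliary file 14: the binomial (de la Vallée-Poussin) test vectors and the
# extraction of a Hausdorff moment sequence at a transverse momentum

Helper file for stub `stub_pickInversion` of line `self-energy-pick-inversion`, crux
`PrecisionLaplacian.DirectCorrelationStableTail` (stmt-CriticalPhenomena-4799). Pure theorem file.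

* `binomialKernel_eq` : for the tensor binomial weights `b(y) = ∏_j C(N, y_j)` on `{0,…,N}²`,
  `∑_{x,y} b x b y cos(u·(x - y)) = 4^N ∏_j (1 + cos u_j)^N` (it is `|∑_x b(x) e^{iu·x}|²`, and
  `∑_m C(N,m) e^{imt} = (1 + e^{it})^N`);
* `exists_hausdorff_measure_at` (registered sub-goal `stub_pickInversion_auxExtraction`): if for every
  finitely supported real `v` on `ℤ²` the sequence `n ↦ ∫_{[-π,π]²} h_n(k) W_v(k) dk`
  (`W_v(k) = ∑_{x,y} v x v y cos(k·(x - y))`) is the moment sequence of a finite positive measure on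
  `[0,1]`, and the `h_n` are integrable on the cube, even under `k ↦ -k` at `k₀ ∈ (-π,π)²` and
  continuous at `±k₀`, then `(h_n(k₀))_n` is the moment sequence of a finite positive measure on
  `[0,1]` (localise with the test vectors `b(y)cos(k₀·y)`, `b(y)sin(k₀·y)`; weak compactness:
  `exists_hausdorffMeasure_of_momentLimit`).
-/

noncomputable section

namespace Summit.CriticalPhenomena.Ising3DConformalLimit.Cruxes.DirectCorrelationStableTail.SelfEnergyPickInversion

open Filter Topology Finset Real MeasureTheory Literature.Probability.LatticeModels
open scoped BigOperators
open Summit.CriticalPhenomena.Ising3DConformalLimit.Theorems.EtaBoundsTransfer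
  (integrableOn_cube_of_continuous volume_cube_lt_top continuous_phase)

/-! ### The binomial kernel -/

/-- `∑_{m=0}^{N} C(N,m) e^{imt} = (e^{it} + 1)^N`. [folklore] -/
theorem sum_choose_mul_cexp (N : ℕ) (t : ℝ) :
    ∑ m ∈ Finset.range (N + 1), (N.choose m : ℂ) * Complex.exp ((m : ℝ) * t * Complex.I) =
      (Complex.exp (t * Complex.I) + 1) ^ N := by
  rw [add_pow]
  refine Finset.sum_congr rfl fun m _ => ?_
  rw [one_pow, mul_one, mul_comm, ← Complex.exp_nat_mul]
  congr 2
  push_cast; ring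

/-- `|e^{it} + 1|² = 2 + 2 cos t`. [folklore] -/
theorem normSq_cexp_add_one (t : ℝ) : Complex.normSq (Complex.exp (t * Complex.I) + 1) = 2 + 2 * Real.cos t := by
  rw [Complex.normSq_apply]
  simp only [Complex.add_re, Complex.exp_ofReal_mul_I_re, Complex.one_re, Complex.add_im,
    Complex.exp_ofReal_mul_I_im, Complex.one_im, add_zero]
  nlinarith [Real.sin_sq_add_cos_sq t]

/-- A real double cosine sum as the squared modulus of a complex sum:
`∑_{x,y∈S} f x f y cos(a_x - a_y) = |∑_{x∈S} f x e^{i a_x}|²`. [folklore] -/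
theorem sum_sum_mul_mul_cos_sub_eq_normSq {α : Type*} (S : Finset α) (f : α → ℝ) (a : α → ℝ) :
    ∑ x ∈ S, ∑ y ∈ S, f x * f y * Real.cos (a x - a y) =
      Complex.normSq (∑ x ∈ S, (f x : ℂ) * Complex.exp ((a x : ℝ) * Complex.I)) := by
  rw [sum_sum_mul_mul_cos_sub, Complex.normSq_apply]
  have hre : (∑ x ∈ S, (f x : ℂ) * Complex.exp ((a x : ℝ) * Complex.I)).re = ∑ x ∈ S, f x * Real.cos (a x) := by
    rw [Complex.re_sum]
    exact Finset.sum_congr rfl fun x _ => by simp [Complex.exp_ofReal_mul_I_re]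
  have him : (∑ x ∈ S, (f x : ℂ) * Complex.exp ((a x : ℝ) * Complex.I)).im = ∑ x ∈ S, f x * Real.sin (a x) := by
    rw [Complex.im_sum]
    exact Finset.sum_congr rfl fun x _ => by simp [Complex.exp_ofReal_mul_I_im]
  rw [hre, him]; ring

/-- **The binomial kernel.** With `s_N = {0,…,N}² ⊂ ℤ²` and `b(y) = ∏_j C(N, (y_j).toNat)`:
`∑_{x,y∈s_N} b x b y cos(u·(x - y)) = 4^N ∏_j (1 + cos u_j)^N`. [folklore] -/
theorem binomialKernel_eq (N : ℕ) (u : Fin 2 → ℝ) :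
    ∑ x ∈ Fintype.piFinset (fun _ : Fin 2 => Finset.Icc (0 : ℤ) N),
      ∑ y ∈ Fintype.piFinset (fun _ : Fin 2 => Finset.Icc (0 : ℤ) N),
        (∏ j, (N.choose (x j).toNat : ℝ)) * (∏ j, (N.choose (y j).toNat : ℝ)) * Real.cos (phase 2 u (x - y)) =
      4 ^ N * ∏ j, (1 + Real.cos (u j)) ^ N := by
  have hphase : ∀ x y : Fin 2 → ℤ, phase 2 u (x - y) = phase 2 u x - phase 2 u y := fun x y => phase_sub u x y
  simp_rw [hphase]
  rw [sum_sum_mul_mul_cos_sub_eq_normSq]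
  -- the complex sum factorises
  have hfac : ∑ x ∈ Fintype.piFinset (fun _ : Fin 2 => Finset.Icc (0 : ℤ) N),
      ((∏ j, (N.choose (x j).toNat : ℝ) : ℝ) : ℂ) * Complex.exp ((phase 2 u x : ℝ) * Complex.I) =
      ∏ j : Fin 2, ∑ t ∈ Finset.Icc (0 : ℤ) N, (N.choose t.toNat : ℂ) * Complex.exp ((u j * t : ℝ) * Complex.I) := by
    rw [Finset.prod_univ_sum]
    refine Finset.sum_congr rfl fun x _ => ?_
    rw [phase, Complex.ofReal_prod]
    push_cast
    rw [Finset.sum_mul, Complex.exp_sum, ← Finset.prod_mul_distrib]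
  -- each factor is `(e^{iu_j} + 1)^N`
  have hone : ∀ j : Fin 2, ∑ t ∈ Finset.Icc (0 : ℤ) N, (N.choose t.toNat : ℂ) * Complex.exp ((u j * t : ℝ) * Complex.I) =
      (Complex.exp (u j * Complex.I) + 1) ^ N := by
    intro j
    have himg : (Finset.range (N + 1)).image (fun m : ℕ => (m : ℤ)) = Finset.Icc (0 : ℤ) N := by
      ext t
      simp only [Finset.mem_image, Finset.mem_range, Finset.mem_Icc]
      constructor
      · rintro ⟨m, hm, rfl⟩; exact ⟨by positivity, by exact_mod_cast Nat.lt_succ_iff.mp hm⟩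
      · rintro ⟨h0, hN⟩
        refine ⟨t.toNat, ?_, Int.toNat_of_nonneg h0⟩
        have : t.toNat ≤ N := Int.toNat_le.mpr hN
        omega
    rw [← sum_choose_mul_cexp N (u j), ← himg, Finset.sum_image (fun m _ m' _ h => by exact_mod_cast h)]
    refine Finset.sum_congr rfl fun m _ => ?_
    simp only [Int.toNat_natCast]
    congr 1
    push_cast; ring_nf
  rw [hfac]
  simp_rw [hone]
  rw [map_prod Complex.normSq]
  simp_rw [map_pow, normSq_cexp_add_one]
  rw [Fin.prod_univ_two, Fin.prod_univ_two, show (4 : ℝ) ^ N = 2 ^ N * 2 ^ N by rw [← mul_pow]; norm_num,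
    show (2 : ℝ) + 2 * Real.cos (u 0) = 2 * (1 + Real.cos (u 0)) by ring,
    show (2 : ℝ) + 2 * Real.cos (u 1) = 2 * (1 + Real.cos (u 1)) by ring, mul_pow, mul_pow]
  ring

/-! ### Extraction of a Hausdorff moment sequence at a transverse momentum -/

/-- The phase is linear in the momentum. [folklore] -/
theorem phase_add_left {d : ℕ} (k k' : Fin d → ℝ) (w : Fin d → ℤ) :
    phase d (k + k') w = phase d k w + phase d k' w := by
  simp [phase, add_mul, Finset.sum_add_distrib]

/-- The phase is linear in the momentum. [folklore] -/
theorem phase_sub_left {d : ℕ} (k k' : Fin d → ℝ) (w : Fin d → ℤ) :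
    phase d (k - k') w = phase d k w - phase d k' w := by
  simp [phase, sub_mul, Finset.sum_sub_distrib]

/-- Moments of order `n` of a finite measure on `[0, 1]` are integrable and bounded by the mass.
[folklore] -/
theorem integrable_pow_of_Icc {ν : Measure ℝ} [IsFiniteMeasure ν] (hν : ν (Set.Icc (0 : ℝ) 1)ᶜ = 0) (n : ℕ) :
    Integrable (fun t : ℝ => t ^ n) ν ∧ ∫ t, t ^ n ∂ν ≤ ∫ t, t ^ 0 ∂ν := by
  have hae : ∀ᵐ t ∂ν, t ∈ Set.Icc (0 : ℝ) 1 := by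
    rw [ae_iff]; simpa only [Set.mem_setOf_eq, ← Set.mem_compl_iff, Set.setOf_mem_eq] using hν
  have hint : ∀ m : ℕ, Integrable (fun t : ℝ => t ^ m) ν := fun m =>
    Integrable.mono' (integrable_const 1) (Measurable.aestronglyMeasurable (by fun_prop))
      (hae.mono fun t ht => by rw [Real.norm_eq_abs, abs_of_nonneg (pow_nonneg ht.1 _)]; exact pow_le_one₀ ht.1 ht.2)
  refine ⟨hint n, integral_mono_ae (hint n) (hint 0) (hae.mono fun t ht => ?_)⟩
  show t ^ n ≤ t ^ 0
  rw [pow_zero]; exact pow_le_one₀ ht.1 ht.2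

/-- **Extraction of a Hausdorff moment sequence at a transverse momentum.** Suppose that for every
finite `s ⊂ ℤ²` and real weights `v` the sequence `n ↦ ∫_{[-π,π]²} h_n(k) W_v(k) dk`,
`W_v(k) = ∑_{x,y∈s} v x v y cos(k·(x - y))`, is the moment sequence of a finite positive measure on
`[0, 1]`, that each `h_n` is integrable on the cube, and that at `k₀ ∈ (-π,π)²` the `h_n` are
continuous at `±k₀` with `h_n(-k₀) = h_n(k₀)`. Then `(h_n(k₀))_n` is the moment sequence of a finite
positive measure on `[0, 1]`. [folklore] -/
theorem exists_hausdorff_measure_at {h : ℕ → (Fin 2 → ℝ) → ℝ}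
    (hHM : ∀ (s : Finset (Fin 2 → ℤ)) (v : (Fin 2 → ℤ) → ℝ), ∃ ν : Measure ℝ, IsFiniteMeasure ν ∧
      ν (Set.Icc (0 : ℝ) 1)ᶜ = 0 ∧ ∀ n : ℕ, ∫ k in Set.pi Set.univ (fun _ : Fin 2 => Set.Icc (-π) π),
        h n k * (∑ x ∈ s, ∑ y ∈ s, v x * v y * Real.cos (phase 2 k (x - y))) = ∫ t, t ^ n ∂ν)
    (hint : ∀ n, IntegrableOn (h n) (Set.pi Set.univ (fun _ : Fin 2 => Set.Icc (-π) π)) volume)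
    {k₀ : Fin 2 → ℝ} (hk₀ : ∀ j, |k₀ j| < π) (hcont : ∀ n, ContinuousAt (h n) k₀)
    (hcont' : ∀ n, ContinuousAt (h n) (-k₀)) (heven : ∀ n, h n (-k₀) = h n k₀) :
    ∃ μ : Measure ℝ, IsFiniteMeasure μ ∧ μ (Set.Icc (0 : ℝ) 1)ᶜ = 0 ∧ ∀ n : ℕ, h n k₀ = ∫ t, t ^ n ∂μ := by
  have hπ := Real.pi_pos
  set K := Set.pi Set.univ (fun _ : Fin 2 => Set.Icc (-π) π) with hK
  -- the test vectors
  set sN : ℕ → Finset (Fin 2 → ℤ) := fun N => Fintype.piFinset (fun _ : Fin 2 => Finset.Icc (0 : ℤ) N) with hsN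
  set b : ℕ → (Fin 2 → ℤ) → ℝ := fun N y => ∏ j, (N.choose (y j).toNat : ℝ) with hb
  set I : ℕ → ℝ := fun N => ∫ t in (-π)..π, (1 + Real.cos t) ^ N with hI
  have hIpos : ∀ N, 0 < I N := fun N => vp_integral_pos N
  -- the combined weight
  have hcomb : ∀ N (k : Fin 2 → ℝ),
      (∑ x ∈ sN N, ∑ y ∈ sN N, (b N x * Real.cos (phase 2 k₀ x)) * (b N y * Real.cos (phase 2 k₀ y)) *
          Real.cos (phase 2 k (x - y))) +
      (∑ x ∈ sN N, ∑ y ∈ sN N, (b N x * Real.sin (phase 2 k₀ x)) * (b N y * Real.sin (phase 2 k₀ y)) *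
          Real.cos (phase 2 k (x - y))) =
      (1 / 2) * (4 ^ N * ∏ j, (1 + Real.cos ((k - k₀) j)) ^ N) +
        (1 / 2) * (4 ^ N * ∏ j, (1 + Real.cos ((k + k₀) j)) ^ N) := by
    intro N k
    rw [← binomialKernel_eq N (k - k₀), ← binomialKernel_eq N (k + k₀), Finset.mul_sum, Finset.mul_sum,
      ← Finset.sum_add_distrib, ← Finset.sum_add_distrib]
    refine Finset.sum_congr rfl fun x _ => ?_
    rw [Finset.mul_sum, Finset.mul_sum, ← Finset.sum_add_distrib, ← Finset.sum_add_distrib]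
    refine Finset.sum_congr rfl fun y _ => ?_
    have h1 : Real.cos (phase 2 k₀ x) * Real.cos (phase 2 k₀ y) + Real.sin (phase 2 k₀ x) * Real.sin (phase 2 k₀ y) =
        Real.cos (phase 2 k₀ (x - y)) := by rw [phase_sub, Real.cos_sub]
    have h2 : Real.cos (phase 2 k₀ (x - y)) * Real.cos (phase 2 k (x - y)) =
        (1 / 2) * Real.cos (phase 2 (k - k₀) (x - y)) + (1 / 2) * Real.cos (phase 2 (k + k₀) (x - y)) := by
      rw [phase_sub_left, phase_add_left, Real.cos_sub, Real.cos_add]; ring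
    simp only [hb]
    set bx : ℝ := ∏ j, (N.choose (x j).toNat : ℝ)
    set bz : ℝ := ∏ j, (N.choose (y j).toNat : ℝ)
    have h3 : bx * Real.cos (phase 2 k₀ x) * (bz * Real.cos (phase 2 k₀ y)) * Real.cos (phase 2 k (x - y)) +
        bx * Real.sin (phase 2 k₀ x) * (bz * Real.sin (phase 2 k₀ y)) * Real.cos (phase 2 k (x - y)) =
        bx * bz * ((Real.cos (phase 2 k₀ x) * Real.cos (phase 2 k₀ y) +
          Real.sin (phase 2 k₀ x) * Real.sin (phase 2 k₀ y)) * Real.cos (phase 2 k (x - y))) := by ring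
    rw [h3, h1, h2]
    ring
  -- integrability of `h_n ·` (continuous weight) on the cube
  have hKc : IsCompact K := isCompact_univ_pi fun _ => isCompact_Icc
  have hKm : MeasurableSet K := MeasurableSet.univ_pi fun _ => measurableSet_Icc
  have hmul : ∀ n {W : (Fin 2 → ℝ) → ℝ}, Continuous W → Integrable (fun k => h n k * W k) (volume.restrict K) := by
    intro n W hW
    obtain ⟨B, hB⟩ := hKc.exists_bound_of_continuousOn hW.continuousOn
    refine (hint n).mul_bdd (c := B) hW.aestronglyMeasurable ?_
    filter_upwards [ae_restrict_mem hKm] with k hk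
    exact hB k hk
  have hWc : ∀ (s : Finset (Fin 2 → ℤ)) (v : (Fin 2 → ℤ) → ℝ),
      Continuous fun k : Fin 2 → ℝ => ∑ x ∈ s, ∑ y ∈ s, v x * v y * Real.cos (phase 2 k (x - y)) := by
    intro s v
    refine continuous_finsetSum _ fun x _ => continuous_finsetSum _ fun y _ => ?_
    have := continuous_phase (d := 2) (x - y); fun_prop
  have hPc : ∀ N (c : Fin 2 → ℝ), Continuous fun k : Fin 2 → ℝ => ∏ j, (1 + Real.cos (k j - c j)) ^ N :=
    fun N c => by fun_prop
  -- the measures `ν_N`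
  have hmeas : ∀ N : ℕ, ∃ ν : Measure ℝ, IsFiniteMeasure ν ∧ ν (Set.Icc (0 : ℝ) 1)ᶜ = 0 ∧ ∀ n : ℕ,
      ∫ t, t ^ n ∂ν = (∫ k in K, h n k * ∏ j, (1 + Real.cos (k j - k₀ j)) ^ N) / (I N) ^ 2 +
        (∫ k in K, h n k * ∏ j, (1 + Real.cos (k j - (-k₀) j)) ^ N) / (I N) ^ 2 := by
    intro N
    obtain ⟨νc, hνc, hνc0, hνcm⟩ := hHM (sN N) (fun y => b N y * Real.cos (phase 2 k₀ y))
    obtain ⟨νs, hνs, hνs0, hνsm⟩ := hHM (sN N) (fun y => b N y * Real.sin (phase 2 k₀ y))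
    set c : ℝ := 2 / (4 ^ N * (I N) ^ 2) with hc
    have hc0 : 0 ≤ c := by positivity
    refine ⟨c.toNNReal • (νc + νs), inferInstance, ?_, fun n => ?_⟩
    · rw [Measure.smul_apply, Measure.add_apply, hνc0, hνs0, add_zero, smul_zero]
    · obtain ⟨hic, -⟩ := integrable_pow_of_Icc hνc0 n
      obtain ⟨his, -⟩ := integrable_pow_of_Icc hνs0 n
      have e1 : ∫ t, t ^ n ∂(c.toNNReal • (νc + νs)) =
          c * ((∫ k in K, h n k * ∑ x ∈ sN N, ∑ y ∈ sN N, (b N x * Real.cos (phase 2 k₀ x)) *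
            (b N y * Real.cos (phase 2 k₀ y)) * Real.cos (phase 2 k (x - y))) +
          ∫ k in K, h n k * ∑ x ∈ sN N, ∑ y ∈ sN N, (b N x * Real.sin (phase 2 k₀ x)) *
            (b N y * Real.sin (phase 2 k₀ y)) * Real.cos (phase 2 k (x - y))) := by
        rw [integral_smul_nnreal_measure, integral_add_measure hic his, ← hνcm n, ← hνsm n, NNReal.smul_def,
          smul_eq_mul, Real.coe_toNNReal _ hc0]
      have e2 : (∫ k in K, h n k * ∑ x ∈ sN N, ∑ y ∈ sN N, (b N x * Real.cos (phase 2 k₀ x)) *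
            (b N y * Real.cos (phase 2 k₀ y)) * Real.cos (phase 2 k (x - y))) +
          (∫ k in K, h n k * ∑ x ∈ sN N, ∑ y ∈ sN N, (b N x * Real.sin (phase 2 k₀ x)) *
            (b N y * Real.sin (phase 2 k₀ y)) * Real.cos (phase 2 k (x - y))) =
          (1 / 2 * 4 ^ N) * (∫ k in K, h n k * ∏ j, (1 + Real.cos (k j - k₀ j)) ^ N) +
          (1 / 2 * 4 ^ N) * (∫ k in K, h n k * ∏ j, (1 + Real.cos (k j - (-k₀) j)) ^ N) := by
        rw [← integral_add (hmul n (hWc _ _)) (hmul n (hWc _ _)), ← integral_const_mul, ← integral_const_mul,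
          ← integral_add ((hmul n (hPc N k₀)).const_mul _) ((hmul n (hPc N (-k₀))).const_mul _)]
        refine integral_congr_ae (Eventually.of_forall fun k => ?_)
        have := hcomb N k
        simp only [Pi.sub_apply, Pi.add_apply, Pi.neg_apply, sub_neg_eq_add] at this ⊢
        rw [← mul_add, this]
        ring
      rw [e1, e2, hc]
      field_simp
  choose ν hνfin hν0 hνmom using hmeas
  -- the limits of the moments
  have hk₀' : ∀ j, |(-k₀) j| < π := fun j => by simpa using hk₀ j
  have hlim : ∀ n, Tendsto (fun N => ∫ t, t ^ n ∂(ν N)) atTop (𝓝 (2 * h n k₀)) := by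
    intro n
    have h1 := tendsto_setIntegral_vp_kernel (hint n) hk₀ (hcont n)
    have h2 := tendsto_setIntegral_vp_kernel (hint n) hk₀' (hcont' n)
    rw [heven n] at h2
    have h3 := h1.add h2
    rw [← two_mul] at h3
    refine h3.congr fun N => ?_
    rw [hνmom N n]
  -- uniform moment bound and weak compactness
  obtain ⟨M, hM⟩ := (hlim 0).bddAbove_range
  have hle : ∀ N n, n ≤ N → ∫ t, t ^ n ∂(ν N) ≤ M := by
    intro N n _
    haveI := hνfin N
    exact ((integrable_pow_of_Icc (hν0 N) n).2).trans (hM ⟨N, rfl⟩)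
  obtain ⟨μ, hμfin, hμ0, hμmom⟩ := exists_hausdorffMeasure_of_momentLimit (fun n => 2 * h n k₀) ν hνfin
    (fun N => measure_mono_null (fun t ht => by
      simp only [Set.mem_Iio] at ht; exact fun h => absurd h.1 (not_le.2 ht)) (hν0 N))
    (fun N n => by haveI := hνfin N; exact (integrable_pow_of_Icc (hν0 N) n).1) hle hlim
  refine ⟨(1 / 2 : NNReal) • μ, inferInstance, ?_, fun n => ?_⟩
  · rw [Measure.smul_apply, hμ0, smul_zero]
  · rw [integral_smul_nnreal_measure, ← hμmom n, NNReal.smul_def, smul_eq_mul]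
    push_cast
    ring

/-- **Registered auxiliary stub `stub_pickInversion_auxExtraction`** (sub-goal of `stub_pickInversion`):
extraction of a Hausdorff moment sequence at a transverse momentum (`exists_hausdorff_measure_at`).
[folklore] -/
theorem stub_pickInversion_auxExtraction : ∀ (h : ℕ → (Fin 2 → ℝ) → ℝ) (k₀ : Fin 2 → ℝ),
    (∀ (s : Finset (Fin 2 → ℤ)) (v : (Fin 2 → ℤ) → ℝ), ∃ ν : MeasureTheory.Measure ℝ,
      MeasureTheory.IsFiniteMeasure ν ∧ ν (Set.Icc (0 : ℝ) 1)ᶜ = 0 ∧ ∀ n : ℕ,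
        ∫ k in Set.pi Set.univ (fun _ : Fin 2 => Set.Icc (-Real.pi) Real.pi),
          h n k * (∑ x ∈ s, ∑ y ∈ s, v x * v y * Real.cos (∑ i, k i * ((x - y) i : ℝ))) = ∫ t, t ^ n ∂ν) →
    (∀ n, MeasureTheory.IntegrableOn (h n) (Set.pi Set.univ (fun _ : Fin 2 => Set.Icc (-Real.pi) Real.pi))) →
    (∀ j, |k₀ j| < Real.pi) → (∀ n, ContinuousAt (h n) k₀) → (∀ n, ContinuousAt (h n) (-k₀)) →
    (∀ n, h n (-k₀) = h n k₀) →
    ∃ μ : MeasureTheory.Measure ℝ, MeasureTheory.IsFiniteMeasure μ ∧ μ (Set.Icc (0 : ℝ) 1)ᶜ = 0 ∧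
      ∀ n : ℕ, h n k₀ = ∫ t, t ^ n ∂μ :=
  fun _ _ hHM hint hk₀ hcont hcont' heven => by
    have h := exists_hausdorff_measure_at (by simpa only [phase] using hHM) hint hk₀ hcont hcont' heven
    exact h

end Summit.CriticalPhenomena.Ising3DConformalLimit.Cruxes.DirectCorrelationStableTail.SelfEnergyPickInversion

end
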